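import Summits.QuantumFields.YangMills.Theorems.PoincareLipschitzCircleWirtingerLetters
import HarnessLib

/-!
# ROAD (W) brick W-WIR, FILE 2∕2 (the annulus): polar coordinates about a centre and the Cauchy–Schwarz row
# `∫ |K(r)| dr∕r ≤ ‖∇a‖_{L²(A)} ‖∇b‖_{L²(A)}`

Cell `ym3-torus` (YM ladder rung R3 = continuum SU(2) Yang–Mills on T³ — a RUNG: NOT d = 4, NOT infinite volume, NOT a mass gap,
NOT the Clay problem), width seat `ym3-torus-px6` g10; `--supports stmt-QuantumFields-23533` (K2 lane, LINE 25, the (TM)∕(GAP)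
discharge road); brick W-WIR of ★w3-19936 g16's ROAD (W) «H-system energy gap at exactly 3π from the sharp two-point Wente bound»
(`ROAD-W-WENTE-3PI-w3g16.md` §2–§3).  Pure planar real analysis for `C¹` data (the road approximates Sobolev data at the 2-d level).

The one-dimensional inputs are ALREADY in the tree (Literature, proved): Wirtinger's inequality with the sharp constant
(`Literature.Analysis.FluidPDE.wirtinger_interval(_real)`), its circle form at the origin `circle_wirtinger_mean`, the circle
parametrisation `circlePt r θ = (r cos θ, r sin θ)` with velocity `perp (circlePt r θ)`, and polar coordinates on
`EuclideanSpace ℝ (Fin 2)` (`integral_eq_integral_circlePt`).  This file is the CENTRED ∕ ANNULAR ADAPTER the one-centre lemma (W-ONE)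
consumes, for `C¹` functions `a b : EuclideanSpace ℝ (Fin 2) → ℝ`, a centre `x₀` and radii `0 < r₀ ≤ r₁` — FILE 2 (this file; FILE 1
`…PoincareLipschitzCircleWirtingerLetters` has the per-circle rows):

* §3 ★ `setIntegral_annulus_eq_polar` ∕ `setIntegral_closedBall_eq_polar` — polar coordinates on the annulus `{r₀ < ‖y − x₀‖ ≤ r₁}` and on
  the disc about `x₀` for continuous integrands (`∫_A f = ∫_{r₀}^{r₁} r·∫_{-π}^{π} f(x₀ + circlePt r θ) dθ dr`);
  ★ `intervalIntegral_angularEnergy_div_le` — `∫_{r₀}^{r₁} (∫ (∂_θ a)² dθ) dr∕r ≤ ∫_A ‖Da‖²` (`|ξ^⊥| = r`); and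
  ★★ `intervalIntegral_abs_angularPairing_div_le` — `∫_{r₀}^{r₁} |K(r)| dr∕r ≤ √(∫_A ‖Da‖²)·√(∫_A ‖Db‖²)`, the row under the road's boxed
  bound `|m(r₁) − m(r₀)| ≤ (1∕π)‖∇a‖_{L²(A)}‖∇b‖_{L²(A)}`;
* §4 ★★ `abs_integral_radialWeight_mul_fderiv_perp_le` — THE W-ONE SOCKET (w7 g15 16:42:32Z §4, token for token): for a continuous radial weight `κ`
  with `|κ(s)|·s ≤ 1` vanishing off `(ρ₀², ρ₁²)`, `|∫ κ(‖y − x₀‖²)·a·Db[(y − x₀)^⊥] dy| ≤ ‖Da‖_{L²(A)}·‖Db‖_{L²(A)}`,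
  `A = {ρ₀ < ‖y − x₀‖ < ρ₁}` (open).

THEOREMS ONLY (0 `def`, 0 `sorry`, default heartbeats).  HONEST SCOPE: elementary letters; nothing of (W-ONE)∕(W-OSC)∕the (GAP)∕(TM),
S1″, K1, `BlockLipschitzL`, `HistoryTailL`, R3, d = 4, a continuum limit or a mass gap is proved here; the Yang–Mills mass gap is NOT proved.

References: G. H. Hardy, J. E. Littlewood, G. Pólya, *Inequalities* (CUP 1952) §7.7 Thm 258 (Wirtinger) [HardyLittlewoodPolya1952];
F. Hélein, *Harmonic maps, conservation laws and moving frames* (CUP 2002) §3.1 (Wente's lemma by polar coordinates and Wirtinger)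
[Helein2002]; P. Topping, The optimal constant in Wente's `L^∞` estimate, Comment. Math. Helv. 72 (1997) 316–328 [Topping1997].
-/

noncomputable section

open MeasureTheory Set Filter Real intervalIntegral
open scoped Topology
open Literature.Analysis.FluidPDE

namespace Summit.QuantumFields.YangMills.Theorems.PoincareLipschitzCircleWirtinger

/-! ## §3 The annulus `A = {r₀ < ‖y − x₀‖ ≤ r₁}`: polar coordinates and the Cauchy–Schwarz row in `dr ∕ r` -/

/-- The shifted annulus indicator: `𝟙_A(x₀ + z)·f(x₀ + z) = 𝟙_{A₀}(z)·f(x₀ + z)` with `A₀ = {r₀ < ‖z‖ ≤ r₁}`. [folklore] -/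
theorem indicator_annulus_comp_add (f : EuclideanSpace ℝ (Fin 2) → ℝ) (x₀ : EuclideanSpace ℝ (Fin 2)) (r₀ r₁ : ℝ)
    (z : EuclideanSpace ℝ (Fin 2)) :
    {y : EuclideanSpace ℝ (Fin 2) | r₀ < ‖y - x₀‖ ∧ ‖y - x₀‖ ≤ r₁}.indicator f (x₀ + z) =
      {z : EuclideanSpace ℝ (Fin 2) | r₀ < ‖z‖ ∧ ‖z‖ ≤ r₁}.indicator (fun z => f (x₀ + z)) z := by
  simp only [Set.indicator, Set.mem_setOf_eq, add_sub_cancel_left]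

/-- Measurability of the centred annulus `{r₀ < ‖z‖ ≤ r₁}`. [folklore] -/
theorem measurableSet_annulus₀ (r₀ r₁ : ℝ) : MeasurableSet {z : EuclideanSpace ℝ (Fin 2) | r₀ < ‖z‖ ∧ ‖z‖ ≤ r₁} :=
  (measurableSet_lt measurable_const continuous_norm.measurable).inter
    (measurableSet_le continuous_norm.measurable measurable_const)

/-- A continuous function is integrable on the (bounded) centred annulus, as an indicator. [folklore] -/
theorem integrable_indicator_annulus₀ {f : EuclideanSpace ℝ (Fin 2) → ℝ} (hf : Continuous f) (r₀ r₁ : ℝ) :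
    Integrable ({z : EuclideanSpace ℝ (Fin 2) | r₀ < ‖z‖ ∧ ‖z‖ ≤ r₁}.indicator f) := by
  rw [integrable_indicator_iff (measurableSet_annulus₀ r₀ r₁)]
  refine (hf.continuousOn.integrableOn_compact (isCompact_closedBall (0 : EuclideanSpace ℝ (Fin 2)) r₁)).mono_set ?_
  intro z hz
  rw [Metric.mem_closedBall, dist_zero_right]
  exact hz.2

/-- ★ **POLAR COORDINATES ON AN ANNULUS ABOUT `x₀`**: for a continuous `f` and `0 ≤ r₀ ≤ r₁`,
`∫_{r₀ < ‖y − x₀‖ ≤ r₁} f(y) dy = ∫_{r₀}^{r₁} r·(∫_{-π}^{π} f(x₀ + circlePt r θ) dθ) dr` (`r₀ = 0`: the punctured disc). [folklore] -/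
theorem setIntegral_annulus_eq_polar {f : EuclideanSpace ℝ (Fin 2) → ℝ} (hf : Continuous f) (x₀ : EuclideanSpace ℝ (Fin 2))
    {r₀ r₁ : ℝ} (hr₀ : 0 ≤ r₀) (hrr : r₀ ≤ r₁) :
    ∫ y in {y : EuclideanSpace ℝ (Fin 2) | r₀ < ‖y - x₀‖ ∧ ‖y - x₀‖ ≤ r₁}, f y =
      ∫ r in r₀..r₁, r * ∫ θ in (-π)..π, f (x₀ + circlePt r θ) := by
  have hA : MeasurableSet {y : EuclideanSpace ℝ (Fin 2) | r₀ < ‖y - x₀‖ ∧ ‖y - x₀‖ ≤ r₁} :=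
    (measurableSet_lt measurable_const (continuous_norm.comp (continuous_id.sub continuous_const)).measurable).inter
      (measurableSet_le (continuous_norm.comp (continuous_id.sub continuous_const)).measurable measurable_const)
  -- move to the centred annulus by translation invariance
  rw [← MeasureTheory.integral_indicator hA, ← integral_add_left_eq_self _ x₀]
  simp_rw [indicator_annulus_comp_add f x₀ r₀ r₁]
  -- polar coordinates at the origin
  have hF := integrable_indicator_annulus₀ (f := fun z => f (x₀ + z)) (hf.comp (continuous_const.add continuous_id)) r₀ r₁
  rw [integral_eq_integral_circlePt hF]
  -- the radial integrand is the indicator of `(r₀, r₁]`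
  have hinner : ∀ ρ ∈ Ioi (0 : ℝ), (∫ θ in Ioc (-π) π, ρ • {z : EuclideanSpace ℝ (Fin 2) | r₀ < ‖z‖ ∧ ‖z‖ ≤ r₁}.indicator
      (fun z => f (x₀ + z)) (circlePt ρ θ)) = (Ioc r₀ r₁).indicator (fun ρ => ρ * ∫ θ in (-π)..π, f (x₀ + circlePt ρ θ)) ρ := by
    intro ρ hρ
    have hρ : 0 < ρ := hρ
    have hπ : -π ≤ π := by linarith [Real.pi_pos]
    by_cases hmem : ρ ∈ Ioc r₀ r₁
    · rw [indicator_of_mem hmem]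
      have hz : ∀ θ : ℝ, circlePt ρ θ ∈ {z : EuclideanSpace ℝ (Fin 2) | r₀ < ‖z‖ ∧ ‖z‖ ≤ r₁} := fun θ => by
        simp only [mem_setOf_eq, norm_circlePt, abs_of_pos hρ]; exact hmem
      simp_rw [indicator_of_mem (hz _), smul_eq_mul]
      rw [MeasureTheory.integral_const_mul, intervalIntegral.integral_of_le hπ]
    · rw [indicator_of_notMem hmem]
      have hz : ∀ θ : ℝ, circlePt ρ θ ∉ {z : EuclideanSpace ℝ (Fin 2) | r₀ < ‖z‖ ∧ ‖z‖ ≤ r₁} := fun θ => by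
        simp only [mem_setOf_eq, norm_circlePt, abs_of_pos hρ]; exact hmem
      simp_rw [indicator_of_notMem (hz _), smul_zero]
      exact integral_zero _ _
  rw [setIntegral_congr_fun measurableSet_Ioi hinner, setIntegral_indicator measurableSet_Ioc,
    show Ioi (0 : ℝ) ∩ Ioc r₀ r₁ = Ioc r₀ r₁ from
      inter_eq_right.2 fun ρ hρ => lt_of_le_of_lt hr₀ hρ.1,
    intervalIntegral.integral_of_le hrr]

/-- ★ **POLAR COORDINATES ON A DISC ABOUT `x₀`** (for the ball averages of W-ONE (a)): for a continuous `f` and `0 ≤ R`,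
`∫_{closedBall x₀ R} f(y) dy = ∫_0^R r·(∫_{-π}^{π} f(x₀ + circlePt r θ) dθ) dr` (the centre is a null set). [folklore] -/
theorem setIntegral_closedBall_eq_polar {f : EuclideanSpace ℝ (Fin 2) → ℝ} (hf : Continuous f) (x₀ : EuclideanSpace ℝ (Fin 2))
    {R : ℝ} (hR : 0 ≤ R) :
    ∫ y in Metric.closedBall x₀ R, f y = ∫ r in (0 : ℝ)..R, r * ∫ θ in (-π)..π, f (x₀ + circlePt r θ) := by
  rw [← setIntegral_annulus_eq_polar hf x₀ le_rfl hR]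
  refine setIntegral_congr_set ?_
  -- `closedBall x₀ R` and the punctured disc differ by the null set `{x₀}`
  have heq : {y : EuclideanSpace ℝ (Fin 2) | 0 < ‖y - x₀‖ ∧ ‖y - x₀‖ ≤ R} = Metric.closedBall x₀ R \ {x₀} := by
    ext y
    simp only [mem_setOf_eq, Set.mem_sdiff, Metric.mem_closedBall, dist_eq_norm, mem_singleton_iff, norm_pos_iff, sub_ne_zero]
    tauto
  rw [heq]
  have h0 : (volume : Measure (EuclideanSpace ℝ (Fin 2))) {x₀} = 0 := measure_singleton x₀
  exact (sdiff_null_ae_eq_self h0).symm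

/-- ★ **THE ANGULAR ENERGY IN `dr∕r` IS DOMINATED BY THE DIRICHLET ENERGY ON THE ANNULUS**: for `a ∈ C¹(ℝ²)`, a centre `x₀` and
`0 < r₀ ≤ r₁`, `∫_{r₀}^{r₁} (∫_{-π}^{π} (Da(x₀+ξ)[ξ^⊥])² dθ) dr∕r ≤ ∫_{r₀ < ‖y − x₀‖ ≤ r₁} ‖Da(y)‖² dy`
(`|ξ^⊥| = r`, polar coordinates;
equality iff `Da` is purely angular on the annulus). [cite: Helein2002, §3.1] -/
theorem intervalIntegral_angularEnergy_div_le {a : EuclideanSpace ℝ (Fin 2) → ℝ} (ha : ContDiff ℝ 1 a) (x₀ : EuclideanSpace ℝ (Fin 2))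
    {r₀ r₁ : ℝ} (hr₀ : 0 < r₀) (hrr : r₀ ≤ r₁) :
    ∫ r in r₀..r₁, (∫ θ in (-π)..π, (fderiv ℝ a (x₀ + circlePt r θ) (perp (circlePt r θ))) ^ 2) / r ≤
      ∫ y in {y : EuclideanSpace ℝ (Fin 2) | r₀ < ‖y - x₀‖ ∧ ‖y - x₀‖ ≤ r₁}, ‖fderiv ℝ a y‖ ^ 2 := by
  have hπ : -π ≤ π := by linarith [Real.pi_pos]
  have hDc : Continuous fun y => ‖fderiv ℝ a y‖ ^ 2 := ((ha.continuous_fderiv one_ne_zero).norm).pow 2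
  rw [setIntegral_annulus_eq_polar hDc x₀ hr₀.le hrr]
  -- both radial integrands are continuous on `[r₀, r₁]`
  have hE := continuous_angularEnergy ha x₀
  have hN : Continuous fun r : ℝ => ∫ θ in (-π)..π, ‖fderiv ℝ a (x₀ + circlePt r θ)‖ ^ 2 := by
    have h : Continuous (Function.uncurry fun (r θ : ℝ) => ‖fderiv ℝ a (x₀ + circlePt r θ)‖ ^ 2) :=
      hDc.comp (continuous_const.add continuous_circlePt_uncurry)
    exact intervalIntegral.continuous_parametric_intervalIntegral_of_continuous' h (-π) π
  have hL : IntervalIntegrable (fun r => (∫ θ in (-π)..π, (fderiv ℝ a (x₀ + circlePt r θ) (perp (circlePt r θ))) ^ 2) / r)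
      volume r₀ r₁ := by
    refine ContinuousOn.intervalIntegrable_of_Icc hrr (hE.continuousOn.div continuousOn_id fun r hr => ?_)
    exact (lt_of_lt_of_le hr₀ hr.1).ne'
  have hR : IntervalIntegrable (fun r => r * ∫ θ in (-π)..π, ‖fderiv ℝ a (x₀ + circlePt r θ)‖ ^ 2) volume r₀ r₁ :=
    (continuous_id.mul hN).intervalIntegrable _ _
  refine intervalIntegral.integral_mono_on hrr hL hR fun r hr => ?_
  have hr : 0 < r := lt_of_lt_of_le hr₀ hr.1
  rw [div_le_iff₀ hr]
  -- pointwise in θ: `(Da ξ^⊥)² ≤ r²‖Da‖²`, then integrate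
  have hθ : ∫ θ in (-π)..π, (fderiv ℝ a (x₀ + circlePt r θ) (perp (circlePt r θ))) ^ 2 ≤
      ∫ θ in (-π)..π, r ^ 2 * ‖fderiv ℝ a (x₀ + circlePt r θ)‖ ^ 2 :=
    intervalIntegral.integral_mono_on hπ ((continuous_fderiv_perp ha x₀ r).pow 2 |>.intervalIntegrable _ _)
      ((continuous_const.mul (hDc.comp (continuous_const.add (continuous_circlePt r)))).intervalIntegrable _ _)
      fun θ _ => sq_fderiv_perp_le a _ r θ
  rw [intervalIntegral.integral_const_mul] at hθ
  nlinarith [hθ]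

/-- ★★ **THE ROW UNDER THE ONE-CENTRE WENTE BOUND**: for `a, b ∈ C¹(ℝ²)`, a centre `x₀` and `0 < r₀ ≤ r₁`, the angular pairing
`K(r) = ∫_{-π}^{π} (a(x₀+ξ) − ā(r))·Db(x₀+ξ)[ξ^⊥] dθ` satisfies `∫_{r₀}^{r₁} |K(r)| dr∕r ≤ ‖Da‖_{L²(A)}·‖Db‖_{L²(A)}`,
`A = {r₀ < ‖y − x₀‖ ≤ r₁}` — Wirtinger on each circle, Cauchy–Schwarz in `θ` and then in `dr∕r`, `|ξ^⊥| = r` (so W-ONE's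
`2π(m(r₁) − m(r₀)) = 2∫_{r₀}^{r₁} K(r) dr∕r` yields `|m(r₁) − m(r₀)| ≤ (1∕π)‖Da‖_{L²(A)}‖Db‖_{L²(A)}`).
[cite: Helein2002, §3.1; Topping1997, Thm 1] -/
theorem intervalIntegral_abs_angularPairing_div_le {a b : EuclideanSpace ℝ (Fin 2) → ℝ} (ha : ContDiff ℝ 1 a) (hb : ContDiff ℝ 1 b)
    (x₀ : EuclideanSpace ℝ (Fin 2)) {r₀ r₁ : ℝ} (hr₀ : 0 < r₀) (hrr : r₀ ≤ r₁) :
    ∫ r in r₀..r₁, |∫ θ in (-π)..π, (a (x₀ + circlePt r θ) - (2 * π)⁻¹ * ∫ t in (-π)..π, a (x₀ + circlePt r t)) *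
        fderiv ℝ b (x₀ + circlePt r θ) (perp (circlePt r θ))| / r ≤
      √(∫ y in {y : EuclideanSpace ℝ (Fin 2) | r₀ < ‖y - x₀‖ ∧ ‖y - x₀‖ ≤ r₁}, ‖fderiv ℝ a y‖ ^ 2) *
        √(∫ y in {y : EuclideanSpace ℝ (Fin 2) | r₀ < ‖y - x₀‖ ∧ ‖y - x₀‖ ≤ r₁}, ‖fderiv ℝ b y‖ ^ 2) := by
  -- abbreviations for the two angular energies (as functions of the radius)
  set α : ℝ → ℝ := fun r => ∫ θ in (-π)..π, (fderiv ℝ a (x₀ + circlePt r θ) (perp (circlePt r θ))) ^ 2 with hα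
  set β : ℝ → ℝ := fun r => ∫ θ in (-π)..π, (fderiv ℝ b (x₀ + circlePt r θ) (perp (circlePt r θ))) ^ 2 with hβ
  have hαc : Continuous α := continuous_angularEnergy ha x₀
  have hβc : Continuous β := continuous_angularEnergy hb x₀
  have hπ : -π ≤ π := by linarith [Real.pi_pos]
  have hα0 : ∀ r, 0 ≤ α r := fun r => intervalIntegral.integral_nonneg hπ fun θ _ => sq_nonneg _
  have hβ0 : ∀ r, 0 ≤ β r := fun r => intervalIntegral.integral_nonneg hπ fun θ _ => sq_nonneg _
  have hKc := continuous_angularPairing ha hb x₀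
  have hne : ∀ r ∈ Icc r₀ r₁, r ≠ 0 := fun r hr => (lt_of_lt_of_le hr₀ hr.1).ne'
  -- step 1: pointwise `|K(r)|/r ≤ √(α r / r)·√(β r / r)`
  have hpt : ∀ r ∈ Icc r₀ r₁, |∫ θ in (-π)..π, (a (x₀ + circlePt r θ) - (2 * π)⁻¹ * ∫ t in (-π)..π, a (x₀ + circlePt r t)) *
      fderiv ℝ b (x₀ + circlePt r θ) (perp (circlePt r θ))| / r ≤ √(α r / r) * √(β r / r) := by
    intro r hr
    have hrp : 0 < r := lt_of_lt_of_le hr₀ hr.1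
    have h := abs_angularPairing_le ha hb x₀ r
    rw [div_le_iff₀ hrp]
    have e : √(α r / r) * √(β r / r) * r = √(α r) * √(β r) := by
      rw [Real.sqrt_div' _ hrp.le, Real.sqrt_div' _ hrp.le]
      have hs := Real.sqrt_pos.2 hrp
      field_simp
      rw [Real.sq_sqrt hrp.le]
      ring
    rw [e]
    exact h
  -- step 2: Cauchy–Schwarz in `dr` on `[r₀, r₁]`
  have hI1 : IntervalIntegrable (fun r => |∫ θ in (-π)..π, (a (x₀ + circlePt r θ) - (2 * π)⁻¹ * ∫ t in (-π)..π,
      a (x₀ + circlePt r t)) * fderiv ℝ b (x₀ + circlePt r θ) (perp (circlePt r θ))| / r) volume r₀ r₁ :=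
    ContinuousOn.intervalIntegrable_of_Icc hrr (hKc.abs.continuousOn.div continuousOn_id hne)
  have hfo : ContinuousOn (fun r => √(α r / r)) (Icc r₀ r₁) :=
    (hαc.continuousOn.div continuousOn_id hne).sqrt
  have hgo : ContinuousOn (fun r => √(β r / r)) (Icc r₀ r₁) :=
    (hβc.continuousOn.div continuousOn_id hne).sqrt
  have hI2 : IntervalIntegrable (fun r => √(α r / r) * √(β r / r)) volume r₀ r₁ :=
    ContinuousOn.intervalIntegrable_of_Icc hrr (hfo.mul hgo)
  have step2 := intervalIntegral.integral_mono_on hrr hI1 hI2 hpt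
  have hCS := abs_intervalIntegral_mul_le_of_continuousOn hrr hfo hgo
  have hnn : 0 ≤ ∫ r in r₀..r₁, √(α r / r) * √(β r / r) :=
    intervalIntegral.integral_nonneg hrr fun r _ => mul_nonneg (Real.sqrt_nonneg _) (Real.sqrt_nonneg _)
  rw [abs_of_nonneg hnn] at hCS
  -- step 3: `∫ (√(α/r))² = ∫ α/r ≤ ∫_A ‖Da‖²` and the same for `b`
  have eα : ∫ r in r₀..r₁, √(α r / r) ^ 2 = ∫ r in r₀..r₁, α r / r :=
    intervalIntegral.integral_congr fun r hr => by
      rw [uIcc_of_le hrr] at hr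
      exact Real.sq_sqrt (div_nonneg (hα0 r) (lt_of_lt_of_le hr₀ hr.1).le)
  have eβ : ∫ r in r₀..r₁, √(β r / r) ^ 2 = ∫ r in r₀..r₁, β r / r :=
    intervalIntegral.integral_congr fun r hr => by
      rw [uIcc_of_le hrr] at hr
      exact Real.sq_sqrt (div_nonneg (hβ0 r) (lt_of_lt_of_le hr₀ hr.1).le)
  rw [eα, eβ] at hCS
  have ha' := Real.sqrt_le_sqrt (intervalIntegral_angularEnergy_div_le ha x₀ hr₀ hrr)
  have hb' := Real.sqrt_le_sqrt (intervalIntegral_angularEnergy_div_le hb x₀ hr₀ hrr)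
  calc _ ≤ ∫ r in r₀..r₁, √(α r / r) * √(β r / r) := step2
    _ ≤ √(∫ r in r₀..r₁, α r / r) * √(∫ r in r₀..r₁, β r / r) := hCS
    _ ≤ _ := mul_le_mul ha' hb' (Real.sqrt_nonneg _) (Real.sqrt_nonneg _)

/-! ## §4 THE W-ONE SOCKET (w7 g15 16:42:32Z §4): the radially weighted planar pairing -/

/-- On the circle of radius `r` about `x₀`, the pairing `∫ a·∂_θ b dθ` equals the centred pairing `∫ (a − ā(r))·∂_θ b dθ`
(periodicity: `∫_{-π}^{π} ∂_θ b dθ = 0`). [folklore] -/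
theorem integral_mul_fderiv_perp_eq_centred {a b : EuclideanSpace ℝ (Fin 2) → ℝ} (ha : Continuous a) (hb : ContDiff ℝ 1 b)
    (x₀ : EuclideanSpace ℝ (Fin 2)) (r : ℝ) :
    ∫ θ in (-π)..π, a (x₀ + circlePt r θ) * fderiv ℝ b (x₀ + circlePt r θ) (perp (circlePt r θ)) =
      ∫ θ in (-π)..π, (a (x₀ + circlePt r θ) - (2 * π)⁻¹ * ∫ t in (-π)..π, a (x₀ + circlePt r t)) *
        fderiv ℝ b (x₀ + circlePt r θ) (perp (circlePt r θ)) := by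
  have hπ : -π ≤ π := by linarith [Real.pi_pos]
  have hd := hb.differentiable one_ne_zero
  have hder : ∀ θ : ℝ, HasDerivAt (fun θ : ℝ => b (x₀ + circlePt r θ)) (fderiv ℝ b (x₀ + circlePt r θ) (perp (circlePt r θ))) θ :=
    fun θ => hasDerivAt_comp_centre_circlePt hd x₀ r θ
  have hper : ∫ θ in (-π)..π, fderiv ℝ b (x₀ + circlePt r θ) (perp (circlePt r θ)) = 0 := by
    rw [intervalIntegral.integral_eq_sub_of_hasDerivAt (fun θ _ => hder θ) ((continuous_fderiv_perp hb x₀ r).intervalIntegrable _ _)]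
    have h := periodic_circlePt r (-π)
    simp only at h
    rw [show -π + 2 * π = π by ring] at h
    rw [h, sub_self]
  have hca := continuous_comp_centre_circlePt ha x₀ r
  have hcb := continuous_fderiv_perp hb x₀ r
  have e : (fun θ : ℝ => (a (x₀ + circlePt r θ) - (2 * π)⁻¹ * ∫ t in (-π)..π, a (x₀ + circlePt r t)) *
      fderiv ℝ b (x₀ + circlePt r θ) (perp (circlePt r θ))) = fun θ =>
        a (x₀ + circlePt r θ) * fderiv ℝ b (x₀ + circlePt r θ) (perp (circlePt r θ)) -
          ((2 * π)⁻¹ * ∫ t in (-π)..π, a (x₀ + circlePt r t)) * fderiv ℝ b (x₀ + circlePt r θ) (perp (circlePt r θ)) := by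
    funext θ; ring
  have i1 : IntervalIntegrable (fun θ : ℝ => a (x₀ + circlePt r θ) * fderiv ℝ b (x₀ + circlePt r θ) (perp (circlePt r θ)))
      volume (-π) π := (hca.mul hcb).intervalIntegrable _ _
  have i2 : IntervalIntegrable (fun θ : ℝ => ((2 * π)⁻¹ * ∫ t in (-π)..π, a (x₀ + circlePt r t)) *
      fderiv ℝ b (x₀ + circlePt r θ) (perp (circlePt r θ))) volume (-π) π := (continuous_const.mul hcb).intervalIntegrable _ _
  rw [e, intervalIntegral.integral_sub i1 i2, intervalIntegral.integral_const_mul, hper, mul_zero, sub_zero]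

/-- The half-open and the open annulus carry the same integrals (the sphere `‖y − x₀‖ = ρ₁` is Lebesgue-null). [folklore] -/
theorem setIntegral_annulus_Ioc_eq_Ioo (f : EuclideanSpace ℝ (Fin 2) → ℝ) (x₀ : EuclideanSpace ℝ (Fin 2)) (ρ₀ ρ₁ : ℝ) :
    ∫ y in {y : EuclideanSpace ℝ (Fin 2) | ρ₀ < ‖y - x₀‖ ∧ ‖y - x₀‖ ≤ ρ₁}, f y =
      ∫ y in {y : EuclideanSpace ℝ (Fin 2) | ρ₀ < ‖y - x₀‖ ∧ ‖y - x₀‖ < ρ₁}, f y := by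
  refine setIntegral_congr_set ?_
  have hS : (volume : Measure (EuclideanSpace ℝ (Fin 2))) (Metric.sphere x₀ ρ₁) = 0 := Measure.addHaar_sphere volume x₀ ρ₁
  have h1 : {y : EuclideanSpace ℝ (Fin 2) | ρ₀ < ‖y - x₀‖ ∧ ‖y - x₀‖ < ρ₁} ⊆ {y | ρ₀ < ‖y - x₀‖ ∧ ‖y - x₀‖ ≤ ρ₁} :=
    fun y hy => ⟨hy.1, hy.2.le⟩
  have h2 : {y : EuclideanSpace ℝ (Fin 2) | ρ₀ < ‖y - x₀‖ ∧ ‖y - x₀‖ ≤ ρ₁} \ {y | ρ₀ < ‖y - x₀‖ ∧ ‖y - x₀‖ < ρ₁} ⊆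
      Metric.sphere x₀ ρ₁ := by
    intro y hy
    rw [Metric.mem_sphere, dist_eq_norm]
    have h := hy.1.2
    have h' : ¬ (‖y - x₀‖ < ρ₁) := fun hlt => hy.2 ⟨hy.1.1, hlt⟩
    exact le_antisymm h (not_lt.1 h')
  have hnull : (volume : Measure (EuclideanSpace ℝ (Fin 2)))
      ({y : EuclideanSpace ℝ (Fin 2) | ρ₀ < ‖y - x₀‖ ∧ ‖y - x₀‖ ≤ ρ₁} \ {y | ρ₀ < ‖y - x₀‖ ∧ ‖y - x₀‖ < ρ₁}) = 0 :=
    measure_mono_null h2 hS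
  -- `s =ᵐ t` iff `μ (s \ t) = 0` and `μ (t \ s) = 0`
  refine (ae_eq_set.2 ⟨hnull, ?_⟩)
  rw [show {y : EuclideanSpace ℝ (Fin 2) | ρ₀ < ‖y - x₀‖ ∧ ‖y - x₀‖ < ρ₁} \ {y | ρ₀ < ‖y - x₀‖ ∧ ‖y - x₀‖ ≤ ρ₁} = ∅ from
    Set.eq_empty_of_subset_empty fun y hy => hy.2 (h1 hy.1), measure_empty]

/-- ★★ **THE W-ONE SOCKET — THE RADIALLY WEIGHTED PLANAR PAIRING IS BOUNDED BY THE ANNULAR DIRICHLET ENERGIES**: for `a, b ∈ C¹(ℝ²)`, a centre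
`x₀`, radii `0 < ρ₀ ≤ ρ₁` and a continuous radial weight `κ` with `|κ(s)|·s ≤ 1` (`s > 0`) vanishing for `s ≤ ρ₀²` and `s ≥ ρ₁²`:
`|∫ κ(‖y − x₀‖²)·a(y)·Db(y)[(y − x₀)^⊥] dy| ≤ ‖Da‖_{L²(A)}·‖Db‖_{L²(A)}`, `A = {ρ₀ < ‖y − x₀‖ < ρ₁}` — polar coordinates
about `x₀`
(the integrand lives on the annulus), `∫ a·∂_θ b dθ = ∫ (a − ā)·∂_θ b dθ` on each circle, `|r·κ(r²)| ≤ 1∕r`, and the `dr∕r` row. This is the text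
asked for by the one-centre lemma's pen (w7 g15 16:42:32Z §4), token for token. [cite: Helein2002, §3.1; Topping1997, Thm 1] -/
theorem abs_integral_radialWeight_mul_fderiv_perp_le {x₀ : EuclideanSpace ℝ (Fin 2)} {ρ₀ ρ₁ : ℝ} (hρ₀ : 0 < ρ₀) (hρ : ρ₀ ≤ ρ₁)
    {κ : ℝ → ℝ} (hκc : Continuous κ) (hκ1 : ∀ s, 0 < s → |κ s| * s ≤ 1) (hκ0 : ∀ s, (s ≤ ρ₀ ^ 2 ∨ ρ₁ ^ 2 ≤ s) → κ s = 0)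
    {a b : EuclideanSpace ℝ (Fin 2) → ℝ} (ha : ContDiff ℝ 1 a) (hb : ContDiff ℝ 1 b) :
    |∫ y, κ (‖y - x₀‖ ^ 2) * a y * fderiv ℝ b y (perp (y - x₀))| ≤
      √(∫ y in {y : EuclideanSpace ℝ (Fin 2) | ρ₀ < ‖y - x₀‖ ∧ ‖y - x₀‖ < ρ₁}, ‖fderiv ℝ a y‖ ^ 2) *
        √(∫ y in {y : EuclideanSpace ℝ (Fin 2) | ρ₀ < ‖y - x₀‖ ∧ ‖y - x₀‖ < ρ₁}, ‖fderiv ℝ b y‖ ^ 2) := by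
  have hπ : -π ≤ π := by linarith [Real.pi_pos]
  -- the integrand and its continuity
  set F : EuclideanSpace ℝ (Fin 2) → ℝ := fun y => κ (‖y - x₀‖ ^ 2) * a y * fderiv ℝ b y (perp (y - x₀)) with hF
  have hFc : Continuous F := by
    have h1 : Continuous fun y : EuclideanSpace ℝ (Fin 2) => κ (‖y - x₀‖ ^ 2) :=
      hκc.comp ((continuous_norm.comp (continuous_id.sub continuous_const)).pow 2)
    have h2 : Continuous fun y : EuclideanSpace ℝ (Fin 2) => fderiv ℝ b y (perp (y - x₀)) :=
      (hb.continuous_fderiv one_ne_zero).clm_apply (continuous_perp.comp (continuous_id.sub continuous_const))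
    exact (h1.mul ha.continuous).mul h2
  -- the integrand vanishes off the half-open annulus
  have hzero : ∀ y, y ∉ {y : EuclideanSpace ℝ (Fin 2) | ρ₀ < ‖y - x₀‖ ∧ ‖y - x₀‖ ≤ ρ₁} → F y = 0 := by
    intro y hy
    simp only [mem_setOf_eq, not_and_or, not_lt, not_le] at hy
    have hk : κ (‖y - x₀‖ ^ 2) = 0 := by
      refine hκ0 _ ?_
      rcases hy with h | h
      · exact Or.inl (by nlinarith [norm_nonneg (y - x₀)])
      · exact Or.inr (by nlinarith [norm_nonneg (y - x₀), hρ₀])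
    simp only [hF, hk, zero_mul]
  rw [show (∫ y, F y) = ∫ y in {y : EuclideanSpace ℝ (Fin 2) | ρ₀ < ‖y - x₀‖ ∧ ‖y - x₀‖ ≤ ρ₁}, F y from
    (setIntegral_eq_integral_of_forall_compl_eq_zero hzero).symm, setIntegral_annulus_eq_polar hFc x₀ hρ₀.le hρ]
  -- on the circle of radius `r`: `F(x₀ + ξ) = κ(r²)·a·∂_θ b`
  have hcirc : ∀ r ∈ Icc ρ₀ ρ₁, (r * ∫ θ in (-π)..π, F (x₀ + circlePt r θ)) =
      r * κ (r ^ 2) * ∫ θ in (-π)..π, (a (x₀ + circlePt r θ) - (2 * π)⁻¹ * ∫ t in (-π)..π, a (x₀ + circlePt r t)) *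
        fderiv ℝ b (x₀ + circlePt r θ) (perp (circlePt r θ)) := by
    intro r hr
    have hr0 : 0 < r := lt_of_lt_of_le hρ₀ hr.1
    have e : ∀ θ : ℝ, F (x₀ + circlePt r θ) = κ (r ^ 2) * (a (x₀ + circlePt r θ) * fderiv ℝ b (x₀ + circlePt r θ) (perp (circlePt r θ))) := by
      intro θ
      simp only [hF, add_sub_cancel_left, norm_circlePt, sq_abs]
      ring
    simp_rw [e]
    rw [intervalIntegral.integral_const_mul, integral_mul_fderiv_perp_eq_centred ha.continuous hb x₀ r]
    ring
  rw [intervalIntegral.integral_congr fun r hr => hcirc r (by rwa [uIcc_of_le hρ] at hr)]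
  -- `|r κ(r²) K(r)| ≤ |K(r)| / r`, integrate, and use the `dr∕r` row
  have hKc := continuous_angularPairing ha hb x₀
  have hne : ∀ r ∈ Icc ρ₀ ρ₁, r ≠ 0 := fun r hr => (lt_of_lt_of_le hρ₀ hr.1).ne'
  have hwc : Continuous fun r : ℝ => r * κ (r ^ 2) := continuous_id.mul (hκc.comp (continuous_id.pow 2))
  have hI1 : IntervalIntegrable (fun r => r * κ (r ^ 2) * ∫ θ in (-π)..π, (a (x₀ + circlePt r θ) -
      (2 * π)⁻¹ * ∫ t in (-π)..π, a (x₀ + circlePt r t)) * fderiv ℝ b (x₀ + circlePt r θ) (perp (circlePt r θ))) volume ρ₀ ρ₁ :=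
    (hwc.mul hKc).intervalIntegrable _ _
  have habs := intervalIntegral.abs_integral_le_integral_abs (μ := volume) hρ (f := fun r => r * κ (r ^ 2) * ∫ θ in (-π)..π,
      (a (x₀ + circlePt r θ) - (2 * π)⁻¹ * ∫ t in (-π)..π, a (x₀ + circlePt r t)) * fderiv ℝ b (x₀ + circlePt r θ) (perp (circlePt r θ)))
  have hI2 : IntervalIntegrable (fun r => |∫ θ in (-π)..π, (a (x₀ + circlePt r θ) - (2 * π)⁻¹ * ∫ t in (-π)..π,
      a (x₀ + circlePt r t)) * fderiv ℝ b (x₀ + circlePt r θ) (perp (circlePt r θ))| / r) volume ρ₀ ρ₁ :=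
    ContinuousOn.intervalIntegrable_of_Icc hρ (hKc.abs.continuousOn.div continuousOn_id hne)
  have hpt : ∀ r ∈ Icc ρ₀ ρ₁, |r * κ (r ^ 2) * ∫ θ in (-π)..π, (a (x₀ + circlePt r θ) - (2 * π)⁻¹ * ∫ t in (-π)..π,
      a (x₀ + circlePt r t)) * fderiv ℝ b (x₀ + circlePt r θ) (perp (circlePt r θ))| ≤
      |∫ θ in (-π)..π, (a (x₀ + circlePt r θ) - (2 * π)⁻¹ * ∫ t in (-π)..π, a (x₀ + circlePt r t)) *
        fderiv ℝ b (x₀ + circlePt r θ) (perp (circlePt r θ))| / r := by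
    intro r hr
    have hr0 : 0 < r := lt_of_lt_of_le hρ₀ hr.1
    have hw : |r * κ (r ^ 2)| ≤ 1 / r := by
      rw [abs_mul, abs_of_pos hr0, le_div_iff₀ hr0]
      have h := hκ1 (r ^ 2) (by positivity)
      nlinarith [abs_nonneg (κ (r ^ 2))]
    rw [abs_mul, div_eq_mul_one_div, mul_comm (|∫ θ in (-π)..π, _|)]
    exact mul_le_mul_of_nonneg_right hw (abs_nonneg _)
  have step := intervalIntegral.integral_mono_on hρ hI1.abs hI2 hpt
  have hrow := intervalIntegral_abs_angularPairing_div_le ha hb x₀ hρ₀ hρ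
  rw [setIntegral_annulus_Ioc_eq_Ioo (fun y => ‖fderiv ℝ a y‖ ^ 2) x₀ ρ₀ ρ₁,
    setIntegral_annulus_Ioc_eq_Ioo (fun y => ‖fderiv ℝ b y‖ ^ 2) x₀ ρ₀ ρ₁] at hrow
  exact habs.trans (step.trans hrow)

end Summit.QuantumFields.YangMills.Theorems.PoincareLipschitzCircleWirtinger

end
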